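import Summits.CriticalPhenomena.SAWScalingLimit.Theorems.SAWLoopFugacityFlowIsingBoundaryRatioSideCrossSeparationHelpers
import Literature.Topology.PlaneTopology.CellSchoenflies
import HarnessLib

/-!
# The chordal chart of a Dobrushin domain, straightened to the unit disc by a homeomorphism of the plane
(line `fk-anchor-transfer`, crux `IsingBoundaryRatio`, stmt-CriticalPhenomena-10650; helper file of the stub
`windowRectPresentation_holds`)

A strengthening of `exists_chart_extension` (`…SideCrossSeparationHelpers.lean`): besides the Carathéodory
extension `g` of the inverse chordal chart `φ⁻¹` (continuous and injective on `closure D ∖ {b}`, real on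
`∂D ∖ {b}`, `g a = 0`) we produce its disc form `σ = C ∘ g` (`C` the Cayley transform) extended by
**Schoenflies** (`JordanDomain.exists_homeomorph_eqOn_closure'`, in the tree) to a HOMEOMORPHISM `H` of
`ℂ`: `H` maps `closure D` onto the closed unit disc, `∂D` onto the unit circle, `ℂ ∖ closure D` onto the
outside, and a boundary point `p ≠ b` to `exp(iθ)` with `θ = π + 2 arctan (g p)` — the angle is a strictly
increasing function of the real chart parameter `g p` (`cayleyFun_ofReal_eq_exp`). This is the form in which
paths OUTSIDE `D` with prescribed order of their feet on `∂D` are drawn (`…WindowRectNonInterleave`).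
[folklore; Pommerenke 1992 Thm 2.6, Cor 2.9]
-/

noncomputable section

open scoped Classical Topology Real
open Filter Set Metric Complex
open Literature.Probability.LatticeModels Literature.Probability.RandomPlanarGeometry
open Literature.Topology.PlaneTopology
open UpperHalfPlane (upperHalfPlaneSet)

namespace Summit.CriticalPhenomena.SAWScalingLimit.Theorems.IsingBoundaryRatio

namespace WindowRect

/-- **The Cayley transform of a real number is the unit complex number of angle `π + 2 arctan u`.**
[folklore] -/
theorem cayleyFun_ofReal_eq_exp (u : ℝ) : cayleyFun (u : ℂ) = exp ((π + 2 * Real.arctan u : ℝ) * I) := by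
  set a := Real.arctan u with ha
  have hcos : Real.cos a ≠ 0 := (Real.cos_arctan_pos u).ne'
  have hu : u = Real.sin a / Real.cos a := by rw [← Real.tan_eq_sin_div_cos, Real.tan_arctan]
  have hden : (u : ℂ) + I ≠ 0 := add_I_ne_zero (by simp)
  have e1 : exp ((π + 2 * a : ℝ) * I) = -exp (a * I) ^ 2 := by
    push_cast
    rw [add_mul, Complex.exp_add, Complex.exp_pi_mul_I, sq, ← Complex.exp_add]
    ring_nf
  have hc : Complex.cos a ≠ 0 := by rw [← Complex.ofReal_cos]; exact_mod_cast hcos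
  have hu' : (u : ℂ) = Complex.sin a / Complex.cos a := by
    rw [hu]; push_cast; rfl
  rw [cayleyFun_apply, e1, div_eq_iff hden, Complex.exp_mul_I, hu']
  field_simp
  linear_combination (Complex.cos ↑a * I - Complex.sin ↑a) * Complex.cos_sq_add_sin_sq (a : ℂ) +
    (2 * Complex.sin ↑a * Complex.cos ↑a ^ 2 + Complex.sin ↑a ^ 3 + Complex.sin ↑a ^ 2 * Complex.cos ↑a * I) *
      Complex.I_sq

/-- **The chordal chart package.** For a chordal uniformizing map `φ` of `(D; a, b)`: the Carathéodory
extension `g` of `φ⁻¹` (continuous and injective on `closure D ∖ {b}`, real on `∂D ∖ {b}`, `g a = 0`) and a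
homeomorphism `H` of `ℂ` mapping `closure D` onto the closed unit disc (and nothing else into it), `∂D` onto
the unit circle, with `H p = exp (i (π + 2 arctan (g p)))` for `p ∈ ∂D ∖ {b}` and `H b = 1`.
[cite: PommerenkeBBCM1992, Thm. 2.6] -/
theorem exists_chart_package {D : DobrushinDomain} {φ : ConformalEquiv upperHalfPlaneSet D.carrier}
    (hφ : D.IsChordalUniformizing φ) :
    ∃ (g : ℂ → ℂ) (H : ℂ ≃ₜ ℂ), ContinuousOn g (closure D.carrier \ {D.pt 1}) ∧ EqOn g φ.symm D.carrier ∧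
      (∀ z ∈ frontier D.carrier, z ≠ D.pt 1 → (g z).im = 0) ∧
      InjOn g (closure D.carrier \ {D.pt 1}) ∧ g (D.pt 0) = 0 ∧
      (∀ z, z ∈ closure D.carrier ↔ ‖H z‖ ≤ 1) ∧
      (∀ z ∈ frontier D.carrier, ‖H z‖ = 1) ∧
      (∀ z ∈ frontier D.carrier, z ≠ D.pt 1 → H z = exp ((π + 2 * Real.arctan (g z).re : ℝ) * I)) ∧
      H (D.pt 1) = 1 := by
  obtain ⟨Ψ, hΨc, hΨeq, hbij, hbijfr⟩ :=
    JordanDomain.exists_continuousOn_extension_holds D.toJordanDomain (cayley.symm.trans φ)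
  have hinj : InjOn Ψ (closedBall 0 1) := hbij.injOn
  set σ : ℂ → ℂ := extendFrom D.carrier fun w => cayleyFun (φ.symm w) with hσ
  have hσΨ : ∀ ζ ∈ closedBall (0 : ℂ) 1, σ (Ψ ζ) = ζ := fun ζ hζ =>
    extendFrom_eq (hbij.mapsTo hζ) (JordanDomain.tendsto_cayleyFun_symm φ hΨc hΨeq hinj hζ)
  have hσc : ContinuousOn σ (closure D.carrier) := by
    refine continuousOn_extendFrom Subset.rfl fun z hz => ?_
    obtain ⟨ζ, hζ, rfl⟩ := hbij.surjOn hz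
    exact ⟨ζ, JordanDomain.tendsto_cayleyFun_symm φ hΨc hΨeq hinj hζ⟩
  have hσmem : ∀ z ∈ closure D.carrier, σ z ∈ closedBall (0 : ℂ) 1 ∧ Ψ (σ z) = z := by
    intro z hz
    obtain ⟨ζ, hζ, rfl⟩ := hbij.surjOn hz
    rw [hσΨ ζ hζ]
    exact ⟨hζ, rfl⟩
  have hb : Ψ 1 = D.pt 1 := JordanDomain.extension_one_eq φ hΨc hΨeq hφ.2
  have hσne : ∀ z ∈ closure D.carrier \ {D.pt 1}, σ z ≠ 1 := by
    rintro z ⟨hz, hzb⟩ h1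
    have := (hσmem z hz).2
    rw [h1, hb] at this
    exact hzb this.symm
  have hσinj : InjOn σ (closure D.carrier) := fun z hz z' hz' h => by
    rw [← (hσmem z hz).2, ← (hσmem z' hz').2, h]
  have hσimage : σ '' closure D.carrier = closedBall 0 1 := by
    apply Subset.antisymm
    · rintro _ ⟨z, hz, rfl⟩; exact (hσmem z hz).1
    · intro ζ hζ; exact ⟨Ψ ζ, hbij.mapsTo hζ, hσΨ ζ hζ⟩
  -- Schoenflies: extend `σ` to a homeomorphism of the plane
  obtain ⟨H, hHσ, -, hHcl, hHext⟩ := D.toJordanDomain.exists_homeomorph_eqOn_closure' hσc hσinj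
  -- the half-plane chart
  set g : ℂ → ℂ := fun z => cayleyInvFun (σ z) with hg
  have hgfr : ∀ z ∈ frontier D.carrier, z ≠ D.pt 1 → (g z).im = 0 := by
    intro z hz _
    obtain ⟨ζ, hζ, rfl⟩ := hbijfr.surjOn hz
    show (cayleyInvFun (σ (Ψ ζ))).im = 0
    rw [hσΨ ζ (sphere_subset_closedBall hζ)]
    exact cayleyInvFun_im_eq_zero (mem_sphere_zero_iff_norm.1 hζ)
  refine ⟨g, H, ?_, ?_, hgfr, ?_, ?_, ?_, ?_, ?_, ?_⟩
  · refine differentiableOn_cayleyInvFun.continuousOn.comp (hσc.mono fun z hz => hz.1) fun z hz => ?_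
    exact hσne z hz
  · intro w hw
    have hw' : 0 ≤ (φ.symm w).im := le_of_lt (φ.symm_mapsTo hw)
    have hζ : cayleyFun (φ.symm w) ∈ closedBall (0 : ℂ) 1 :=
      ball_subset_closedBall (cayley.mapsTo (φ.symm_mapsTo hw))
    have h1 : σ w = cayleyFun (φ.symm w) := by
      have h2 := hσΨ _ hζ
      rwa [JordanDomain.apply_cayleyFun_symm φ hΨeq hw] at h2
    show cayleyInvFun (σ w) = φ.symm w
    rw [h1, cayleyInvFun_cayleyFun (add_I_ne_zero hw')]
  · intro z hz z' hz' h
    have h1 : cayleyFun (cayleyInvFun (σ z)) = cayleyFun (cayleyInvFun (σ z')) := by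
      show cayleyFun (g z) = _
      rw [h]
    rw [cayleyFun_cayleyInvFun (hσne z hz), cayleyFun_cayleyInvFun (hσne z' hz')] at h1
    exact hσinj hz.1 hz'.1 h1
  · have ha : Ψ (cayleyFun ((0 : ℝ) : ℂ)) = D.pt 0 := JordanDomain.extension_cayleyFun_eq φ hΨc hΨeq hφ.1
    have h0 : cayleyFun ((0 : ℝ) : ℂ) ∈ closedBall (0 : ℂ) 1 :=
      mem_closedBall_zero_iff.2 (norm_cayleyFun_ofReal 0).le
    show cayleyInvFun (σ (D.pt 0)) = 0
    rw [← ha, hσΨ _ h0, cayleyInvFun_cayleyFun (add_I_ne_zero (by simp))]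
    simp
  · intro z
    constructor
    · intro hz
      rw [hHσ hz]
      exact mem_closedBall_zero_iff.1 (hσmem z hz).1
    · intro hz
      by_contra hzD
      have : H z ∈ (σ '' closure D.carrier)ᶜ := by
        rw [← hHext]; exact ⟨z, hzD, rfl⟩
      rw [hσimage] at this
      exact this (mem_closedBall_zero_iff.2 hz)
  · intro z hz
    rw [hHσ (frontier_subset_closure hz)]
    obtain ⟨ζ, hζ, rfl⟩ := hbijfr.surjOn hz
    rw [hσΨ ζ (sphere_subset_closedBall hζ)]
    exact mem_sphere_zero_iff_norm.1 hζ
  · intro z hz hzb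
    have hzcl : z ∈ closure D.carrier := frontier_subset_closure hz
    rw [hHσ hzcl, ← cayleyFun_ofReal_eq_exp]
    have hreal : ((g z).re : ℂ) = g z := by
      apply Complex.ext
      · simp
      · simp [hgfr z hz hzb]
    rw [hreal]
    show σ z = cayleyFun (cayleyInvFun (σ z))
    rw [cayleyFun_cayleyInvFun (hσne z ⟨hzcl, hzb⟩)]
  · have hbcl : D.pt 1 ∈ closure D.carrier := by rw [← hb]; exact hbij.mapsTo (mem_closedBall_zero_iff.2 (by simp))
    rw [hHσ hbcl, ← hb, hσΨ 1 (mem_closedBall_zero_iff.2 (by simp))]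

end WindowRect

/-- **The Cayley transform of a real number as a unit complex number**, closed form (registered sub-goal of
stmt-CriticalPhenomena-10650). [folklore] -/
theorem windowRect_cayleyFun_ofReal_eq_exp : ∀ (u : ℝ), Literature.Probability.RandomPlanarGeometry.cayleyFun (u : ℂ) = Complex.exp ((Real.pi + 2 * Real.arctan u : ℝ) * Complex.I) :=
  WindowRect.cayleyFun_ofReal_eq_exp

end Summit.CriticalPhenomena.SAWScalingLimit.Theorems.IsingBoundaryRatio

end
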